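import Mathlib.Analysis.InnerProductSpace.LinearMap
import Mathlib.Analysis.Normed.Module.FiniteDimension
import Mathlib.Analysis.SpecialFunctions.Trigonometric.Deriv
import Mathlib.Analysis.Calculus.ParametricIntegral
import Mathlib.MeasureTheory.Measure.Haar.InnerProductSpace
import Mathlib.MeasureTheory.Integral.Bochner.Set
import Mathlib.MeasureTheory.Integral.IntervalIntegral.FundThmCalculus
import Literature.Analysis.FluidPDE.SphereIntegral
import HarnessLib

/-!
# Planar rotations and the rotation invariance of shell integrals

Analysis support file (everything proved; one definition, no named facts) for the cylindrical
coordinates of A. Waldron, *Long-time existence for Yang–Mills flow*, Invent. math. 217 (2019),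
§4: integration by parts on spheres `S³_r ⊂ ℝ⁴` for the angular-momentum vector fields
`L_{uv}(x) = ⟨x,u⟩v − ⟨x,v⟩u` (the generators of the rotations in the `(u, v)`-plane), in the
rotation-invariant form "the integral of `∂_{L_{uv}} q` over a spherical shell vanishes".

* `planarRotationMap u v α` — the rotation by the angle `α` in the plane of an orthonormal pair
  `u, v` (identity on the orthogonal complement), as a linear map, with
  `inner_planarRotationMap` (it preserves the inner product), `norm_planarRotationMap`,
  `hasDerivAt_planarRotationMap` (`d/dα Rα x = −sin α (⟨x,u⟩u + ⟨x,v⟩v) + cos α L_{uv} x`);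
* `planarRotation u v α : E ≃ₗᵢ[ℝ] E` — the same as a linear isometry equivalence;
* `setIntegral_shell_comp_planarRotation` — `∫_{a<‖x‖<b} q(Rα x) dx = ∫_{a<‖x‖<b} q`;
* `setIntegral_shell_fderiv_angular_eq_zero` — **`∫_{a<‖x‖<b} ∂_{L_{uv}} q = 0`** for `q` of class
  `C¹` away from the origin (`0 < a`);
* `sphereIntegral_fderiv_angular_eq_zero` — **`∫_{S} ∂_{L_{uv}} q (rθ) dσ(θ) = 0`** (`r > 0`): the
  integral of an angular derivative over a sphere vanishes (integration by parts on `S^{n-1}_r`).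

References: A. Waldron, Invent. math. 217 (2019), §4.2 [Waldron2019]; (rotation invariance of
Lebesgue measure) [folklore].
-/

noncomputable section

open MeasureTheory Set Metric Filter Real
open scoped Topology RealInnerProductSpace

namespace Literature.Analysis.Calculus

variable {E : Type*} [NormedAddCommGroup E] [InnerProductSpace ℝ E]

/-- **The rotation by the angle `α` in the plane of the pair `u, v`** (meant for `u, v`
orthonormal; identity on the orthogonal complement):
`Rα x = x + (cos α − 1)(⟨x,u⟩u + ⟨x,v⟩v) + sin α (⟨x,u⟩v − ⟨x,v⟩u)`. [folklore] -/
def planarRotationMap (u v : E) (α : ℝ) : E →ₗ[ℝ] E :=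
  LinearMap.id +
    (Real.cos α - 1) • ((innerSL ℝ u).toLinearMap.smulRight u + (innerSL ℝ v).toLinearMap.smulRight v) +
    Real.sin α • ((innerSL ℝ u).toLinearMap.smulRight v - (innerSL ℝ v).toLinearMap.smulRight u)

/-- The formula for `planarRotationMap`. [folklore] -/
theorem planarRotationMap_apply (u v : E) (α : ℝ) (x : E) :
    planarRotationMap u v α x =
      x + (Real.cos α - 1) • (⟪x, u⟫ • u + ⟪x, v⟫ • v) + Real.sin α • (⟪x, u⟫ • v - ⟪x, v⟫ • u) := by
  simp [planarRotationMap, real_inner_comm]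

/-- **Planar rotations preserve the inner product** (for an orthonormal pair `u ⊥ v`).
[folklore] -/
theorem inner_planarRotationMap {u v : E} (hu : ‖u‖ = 1) (hv : ‖v‖ = 1) (huv : ⟪u, v⟫ = 0)
    (α : ℝ) (x y : E) :
    ⟪planarRotationMap u v α x, planarRotationMap u v α y⟫ = ⟪x, y⟫ := by
  have huu : ⟪u, u⟫ = 1 := by rw [real_inner_self_eq_norm_sq, hu, one_pow]
  have hvv : ⟪v, v⟫ = 1 := by rw [real_inner_self_eq_norm_sq, hv, one_pow]
  have hvu : ⟪v, u⟫ = 0 := by rw [real_inner_comm]; exact huv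
  rw [planarRotationMap_apply, planarRotationMap_apply]
  simp only [inner_add_left, inner_add_right, inner_smul_left, inner_smul_right, inner_sub_left,
    inner_sub_right, huu, hvv, huv, hvu, RCLike.conj_to_real]
  simp only [real_inner_comm u y, real_inner_comm v y]
  linear_combination (⟪x, u⟫ * ⟪u, y⟫ + ⟪x, v⟫ * ⟪v, y⟫) * Real.sin_sq_add_cos_sq α

/-- Planar rotations preserve norms. [folklore] -/
theorem norm_planarRotationMap {u v : E} (hu : ‖u‖ = 1) (hv : ‖v‖ = 1) (huv : ⟪u, v⟫ = 0)
    (α : ℝ) (x : E) : ‖planarRotationMap u v α x‖ = ‖x‖ := by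
  have h := inner_planarRotationMap hu hv huv α x x
  rw [real_inner_self_eq_norm_sq, real_inner_self_eq_norm_sq] at h
  rw [← Real.sqrt_sq (norm_nonneg (planarRotationMap u v α x)), ← Real.sqrt_sq (norm_nonneg x), h]

/-- **The planar rotation as a linear isometry equivalence** (finite-dimensional `E`).
[folklore] -/
def planarRotation [FiniteDimensional ℝ E] {u v : E} (hu : ‖u‖ = 1) (hv : ‖v‖ = 1)
    (huv : ⟪u, v⟫ = 0) (α : ℝ) : E ≃ₗᵢ[ℝ] E :=
  ((planarRotationMap u v α).isometryOfInner (inner_planarRotationMap hu hv huv α)).toLinearIsometryEquiv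
    rfl

/-- The formula for `planarRotation`. [folklore] -/
theorem planarRotation_apply [FiniteDimensional ℝ E] {u v : E} (hu : ‖u‖ = 1) (hv : ‖v‖ = 1)
    (huv : ⟪u, v⟫ = 0) (α : ℝ) (x : E) :
    planarRotation hu hv huv α x = planarRotationMap u v α x := rfl

/-- **The angular velocity of the planar rotation**: `α ↦ Rα x` has derivative
`−sin α (⟨x,u⟩u + ⟨x,v⟩v) + cos α (⟨x,u⟩v − ⟨x,v⟩u)`; at `α = 0` this is the angular-momentum
vector field `L_{uv}(x) = ⟨x,u⟩v − ⟨x,v⟩u`. [folklore] -/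
theorem hasDerivAt_planarRotationMap (u v : E) (x : E) (α : ℝ) :
    HasDerivAt (fun β => planarRotationMap u v β x)
      (-Real.sin α • (⟪x, u⟫ • u + ⟪x, v⟫ • v) + Real.cos α • (⟪x, u⟫ • v - ⟪x, v⟫ • u)) α := by
  have h1 : HasDerivAt (fun β => (Real.cos β - 1) • (⟪x, u⟫ • u + ⟪x, v⟫ • v))
      ((-Real.sin α) • (⟪x, u⟫ • u + ⟪x, v⟫ • v)) α :=
    ((Real.hasDerivAt_cos α).sub_const 1).smul_const _
  have h2 : HasDerivAt (fun β => Real.sin β • (⟪x, u⟫ • v - ⟪x, v⟫ • u))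
      (Real.cos α • (⟪x, u⟫ • v - ⟪x, v⟫ • u)) α :=
    (Real.hasDerivAt_sin α).smul_const _
  have h : HasDerivAt (fun β => x + (Real.cos β - 1) • (⟪x, u⟫ • u + ⟪x, v⟫ • v) +
      Real.sin β • (⟪x, u⟫ • v - ⟪x, v⟫ • u))
      (0 + (-Real.sin α) • (⟪x, u⟫ • u + ⟪x, v⟫ • v) + Real.cos α • (⟪x, u⟫ • v - ⟪x, v⟫ • u)) α :=
    ((hasDerivAt_const α x).add h1).add h2
  rw [zero_add] at h
  refine h.congr_of_eventuallyEq (Eventually.of_forall fun β => ?_)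
  simp only [planarRotationMap_apply]

section Shell

variable [FiniteDimensional ℝ E] [MeasurableSpace E] [BorelSpace E]

/-- **Rotation invariance of shell integrals**: for an orthonormal pair `u ⊥ v` and any angle,
`∫_{a<‖x‖<b} q(Rα x) dx = ∫_{a<‖x‖<b} q(x) dx` (Lebesgue measure is rotation invariant and the
shell is rotation invariant). [folklore] -/
theorem setIntegral_shell_comp_planarRotation {u v : E} (hu : ‖u‖ = 1) (hv : ‖v‖ = 1)
    (huv : ⟪u, v⟫ = 0) (α : ℝ) (q : E → ℝ) (a b : ℝ) :
    ∫ x in {x : E | a < ‖x‖ ∧ ‖x‖ < b}, q (planarRotationMap u v α x) =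
      ∫ x in {x : E | a < ‖x‖ ∧ ‖x‖ < b}, q x := by
  set R := planarRotation hu hv huv α with hR
  have hmp : MeasurePreserving R := R.measurePreserving
  have hpre : R ⁻¹' {x : E | a < ‖x‖ ∧ ‖x‖ < b} = {x : E | a < ‖x‖ ∧ ‖x‖ < b} := by
    ext x
    simp only [mem_preimage, mem_setOf_eq, hR, planarRotation_apply,
      norm_planarRotationMap hu hv huv]
  have h := hmp.setIntegral_preimage_emb R.toHomeomorph.measurableEmbedding q
    {x : E | a < ‖x‖ ∧ ‖x‖ < b}
  rw [hpre] at h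
  simpa [hR, planarRotation_apply] using h

/-- **Shell integration by parts for angular derivatives, rotation-invariant form.** For an
orthonormal pair `u ⊥ v`, `0 < a`, and `q` of class `C¹` away from the origin:
`∫_{a<‖x‖<b} Dq(x)(⟨x,u⟩v − ⟨x,v⟩u) dx = 0` (differentiate the rotation invariance
`∫ q ∘ Rα = ∫ q` at `α = 0`). [folklore] -/
theorem setIntegral_shell_fderiv_angular_eq_zero {u v : E} (hu : ‖u‖ = 1) (hv : ‖v‖ = 1)
    (huv : ⟪u, v⟫ = 0) {q : E → ℝ} (hq : ContDiffOn ℝ 1 q {0}ᶜ) {a b : ℝ} (ha : 0 < a) :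
    ∫ x in {x : E | a < ‖x‖ ∧ ‖x‖ < b}, fderiv ℝ q x (⟪x, u⟫ • v - ⟪x, v⟫ • u) = 0 := by
  set U : Set E := {0}ᶜ with hUdef
  have hU : IsOpen U := isOpen_compl_singleton
  have hsub : {x : E | a ≤ ‖x‖ ∧ ‖x‖ ≤ b} ⊆ U := fun x hx h0 => by
    have : ‖x‖ = 0 := by rw [show x = 0 from h0, norm_zero]
    linarith [hx.1]
  set S : Set E := {x : E | a < ‖x‖ ∧ ‖x‖ < b} with hS
  set K : Set E := {x : E | a ≤ ‖x‖ ∧ ‖x‖ ≤ b} with hK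
  have hSK : S ⊆ K := fun x hx => ⟨hx.1.le, hx.2.le⟩
  have hKc : IsCompact K := by
    have : K = closedBall (0 : E) b \ ball 0 a := by
      ext x; simp [hK, and_comm]
    rw [this]
    exact (isCompact_closedBall 0 b).diff isOpen_ball
  have hSm : MeasurableSet S :=
    (isOpen_lt continuous_const continuous_norm).inter (isOpen_lt continuous_norm continuous_const)
      |>.measurableSet
  have hSfin : volume S < ⊤ := (hKc.measure_lt_top).trans_le' (measure_mono hSK)
  -- `q` and `Dq` are continuous near `K`; a bound for `‖Dq‖` on `K`
  have hqd : ∀ x ∈ U, HasFDerivAt q (fderiv ℝ q x) x := fun x hx =>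
    ((hq.differentiableOn one_ne_zero).differentiableAt (hU.mem_nhds hx)).hasFDerivAt
  have hfc : ContinuousOn (fun x => fderiv ℝ q x) U := hq.continuousOn_fderiv_of_isOpen hU le_rfl
  obtain ⟨M, hM⟩ := hKc.exists_bound_of_continuousOn (hfc.mono hsub)
  -- the rotations keep the shell (and `K`) invariant
  have hRK : ∀ β (x : E), x ∈ K → planarRotationMap u v β x ∈ K := fun β x hx => by
    simp only [hK, mem_setOf_eq, norm_planarRotationMap hu hv huv] at hx ⊢; exact hx
  -- ### the function `F(β) = ∫_S q(Rβ x) dx` is constant …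
  set F : ℝ → ℝ := fun β => ∫ x in S, q (planarRotationMap u v β x) with hF
  have hFconst : ∀ β, F β = F 0 := fun β => by
    simp only [hF, hS]
    rw [setIntegral_shell_comp_planarRotation hu hv huv β q a b,
      setIntegral_shell_comp_planarRotation hu hv huv 0 q a b]
  -- ### … and differentiable at `0` with derivative `∫_S Dq(x)(L x) dx`
  set G : ℝ → E → ℝ := fun β x => fderiv ℝ q (planarRotationMap u v β x)
    (-Real.sin β • (⟪x, u⟫ • u + ⟪x, v⟫ • v) + Real.cos β • (⟪x, u⟫ • v - ⟪x, v⟫ • u)) with hG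
  have hR_cont : ∀ β, Continuous fun x : E => planarRotationMap u v β x := fun β =>
    (planarRotationMap u v β).continuous_of_finiteDimensional
  have hmeas : ∀ β, AEStronglyMeasurable (fun x => q (planarRotationMap u v β x))
      (volume.restrict S) := by
    intro β
    refine ContinuousOn.aestronglyMeasurable ?_ hSm
    exact (hq.continuousOn.mono hsub).comp (hR_cont β).continuousOn fun x hx => hRK β x (hSK hx)
  have hcontK : ∀ β, ContinuousOn (fun x => q (planarRotationMap u v β x)) K := fun β =>
    (hq.continuousOn.mono hsub).comp (hR_cont β).continuousOn fun x hx => hRK β x hx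
  have hint0 : Integrable (fun x => q (planarRotationMap u v 0 x)) (volume.restrict S) :=
    ((hcontK 0).integrableOn_compact hKc).mono_set hSK
  -- the derivative integrand and its bound on `S`
  have hGdiff : ∀ x ∈ S, ∀ β : ℝ, HasDerivAt (fun β' => q (planarRotationMap u v β' x)) (G β x) β := by
    intro x hx β
    have hy : planarRotationMap u v β x ∈ U := hsub (hRK β x (hSK hx))
    exact (hqd _ hy).comp_hasDerivAt β (hasDerivAt_planarRotationMap u v x β)
  have hGbound : ∀ x ∈ S, ∀ β : ℝ, ‖G β x‖ ≤ M * (2 * b + 2 * b) := by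
    intro x hx β
    have hxK := hRK β x (hSK hx)
    have hxb : ‖x‖ ≤ b := hx.2.le
    have h1 : ‖fderiv ℝ q (planarRotationMap u v β x)‖ ≤ M := hM _ hxK
    have hxu : |⟪x, u⟫| ≤ ‖x‖ := by simpa [hu] using abs_real_inner_le_norm x u
    have hxv : |⟪x, v⟫| ≤ ‖x‖ := by simpa [hv] using abs_real_inner_le_norm x v
    have hw₁ : ‖⟪x, u⟫ • u + ⟪x, v⟫ • v‖ ≤ 2 * b := by
      calc ‖⟪x, u⟫ • u + ⟪x, v⟫ • v‖ ≤ ‖⟪x, u⟫ • u‖ + ‖⟪x, v⟫ • v‖ := norm_add_le _ _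
        _ = |⟪x, u⟫| + |⟪x, v⟫| := by rw [norm_smul, norm_smul, hu, hv, mul_one, mul_one,
            Real.norm_eq_abs, Real.norm_eq_abs]
        _ ≤ 2 * b := by linarith
    have hw₂ : ‖⟪x, u⟫ • v - ⟪x, v⟫ • u‖ ≤ 2 * b := by
      calc ‖⟪x, u⟫ • v - ⟪x, v⟫ • u‖ ≤ ‖⟪x, u⟫ • v‖ + ‖⟪x, v⟫ • u‖ := norm_sub_le _ _
        _ = |⟪x, u⟫| + |⟪x, v⟫| := by rw [norm_smul, norm_smul, hu, hv, mul_one, mul_one,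
            Real.norm_eq_abs, Real.norm_eq_abs]
        _ ≤ 2 * b := by linarith
    have hvec : ‖-Real.sin β • (⟪x, u⟫ • u + ⟪x, v⟫ • v) + Real.cos β • (⟪x, u⟫ • v - ⟪x, v⟫ • u)‖ ≤
        2 * b + 2 * b := by
      calc ‖-Real.sin β • (⟪x, u⟫ • u + ⟪x, v⟫ • v) + Real.cos β • (⟪x, u⟫ • v - ⟪x, v⟫ • u)‖
          ≤ ‖-Real.sin β • (⟪x, u⟫ • u + ⟪x, v⟫ • v)‖ + ‖Real.cos β • (⟪x, u⟫ • v - ⟪x, v⟫ • u)‖ :=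
            norm_add_le _ _
        _ ≤ 1 * (2 * b) + 1 * (2 * b) := by
            rw [norm_smul, norm_smul]
            exact add_le_add (mul_le_mul (by rw [Real.norm_eq_abs, abs_neg]; exact Real.abs_sin_le_one β)
              hw₁ (norm_nonneg _) zero_le_one)
              (mul_le_mul (by rw [Real.norm_eq_abs]; exact Real.abs_cos_le_one β) hw₂ (norm_nonneg _)
                zero_le_one)
        _ = 2 * b + 2 * b := by ring
    have hM0 : 0 ≤ M := (norm_nonneg _).trans h1
    calc ‖G β x‖ ≤ ‖fderiv ℝ q (planarRotationMap u v β x)‖ *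
        ‖-Real.sin β • (⟪x, u⟫ • u + ⟪x, v⟫ • v) + Real.cos β • (⟪x, u⟫ • v - ⟪x, v⟫ • u)‖ :=
          ContinuousLinearMap.le_opNorm _ _
      _ ≤ M * (2 * b + 2 * b) := mul_le_mul h1 hvec (norm_nonneg _) hM0
  have hGmeas : AEStronglyMeasurable (G 0) (volume.restrict S) := by
    refine ContinuousOn.aestronglyMeasurable ?_ hSm
    refine ContinuousOn.clm_apply ?_ ?_
    · exact (hfc.mono hsub).comp (hR_cont 0).continuousOn (fun x hx => hRK 0 x (hSK hx))
    · fun_prop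
  haveI : IsFiniteMeasure (volume.restrict S) := ⟨by rw [Measure.restrict_apply_univ]; exact hSfin⟩
  have hderiv := hasDerivAt_integral_of_dominated_loc_of_deriv_le (μ := volume.restrict S)
    (F := fun β x => q (planarRotationMap u v β x)) (F' := G) (x₀ := (0 : ℝ)) (s := univ)
    (bound := fun _ => M * (2 * b + 2 * b)) univ_mem (Eventually.of_forall hmeas) hint0 hGmeas
    ((ae_restrict_mem hSm).mono fun x hx β _ => hGbound x hx β)
    (integrable_const _) ((ae_restrict_mem hSm).mono fun x hx β _ => hGdiff x hx β)
  -- ### the derivative of the constant function `F` vanishes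
  have hF' : HasDerivAt F (∫ x in S, G 0 x) 0 := hderiv.2
  have hF0 : HasDerivAt F 0 0 := by
    have : F = fun _ => F 0 := funext hFconst
    rw [this]; exact hasDerivAt_const 0 _
  have heq : (∫ x in S, G 0 x) = 0 := hF'.unique hF0
  -- `G 0 x = Dq(x)(L x)`
  have hG0 : ∀ x, G 0 x = fderiv ℝ q x (⟪x, u⟫ • v - ⟪x, v⟫ • u) := fun x => by
    simp only [hG, Real.sin_zero, Real.cos_zero, neg_zero, zero_smul, zero_add, one_smul]
    congr 1
    rw [planarRotationMap_apply]; simp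
  simpa only [hG0] using heq

/-- **The integral of an angular derivative over a sphere vanishes** (`r > 0`): for an orthonormal
pair `u ⊥ v` and `q` of class `C¹` away from the origin,
`∫_S Dq(rθ)(⟨rθ,u⟩v − ⟨rθ,v⟩u) dσ(θ) = 0` — integration by parts on the sphere `S_r` for the
divergence-free tangential vector field `L_{uv}` (from the shell version by polar coordinates and
the fundamental theorem of calculus in the outer radius). [folklore] -/
theorem sphereIntegral_fderiv_angular_eq_zero [Nontrivial E] {u v : E} (hu : ‖u‖ = 1)
    (hv : ‖v‖ = 1) (huv : ⟪u, v⟫ = 0) {q : E → ℝ} (hq : ContDiffOn ℝ 1 q {0}ᶜ) {r : ℝ}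
    (hr : 0 < r) :
    Literature.Analysis.FluidPDE.sphereIntegral (volume : Measure E)
      (fun x => fderiv ℝ q x (⟪x, u⟫ • v - ⟪x, v⟫ • u)) r = 0 := by
  set G : E → ℝ := fun x => fderiv ℝ q x (⟪x, u⟫ • v - ⟪x, v⟫ • u) with hG
  have hO : IsOpen ({0}ᶜ : Set E) := isOpen_compl_singleton
  have hGc : ContinuousOn G {0}ᶜ := by
    refine ContinuousOn.clm_apply (hq.continuousOn_fderiv_of_isOpen hO le_rfl) ?_
    fun_prop
  set Sph : ℝ → ℝ := Literature.Analysis.FluidPDE.sphereIntegral (volume : Measure E) G with hSph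
  have hSphc : ContinuousOn Sph (Ioi 0) :=
    Literature.Analysis.FluidPDE.continuousOn_sphereIntegral_Ioi (volume : Measure E) hGc
  set h : ℝ → ℝ := fun ρ => ρ ^ (Module.finrank ℝ E - 1) • Sph ρ with hh
  have hhc : ContinuousOn h (Ioi 0) := (continuousOn_id.pow _).smul hSphc
  -- the integral of `h` over every interval `(a, b)` with `0 < a` vanishes
  have hint : ∀ {a b : ℝ}, 0 < a → a ≤ b → ∫ ρ in a..b, h ρ = 0 := by
    intro a b ha hab
    have hK : IsCompact {x : E | a / 2 ≤ ‖x‖ ∧ ‖x‖ ≤ b + 1} := by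
      have : {x : E | a / 2 ≤ ‖x‖ ∧ ‖x‖ ≤ b + 1} = closedBall (0 : E) (b + 1) \ ball 0 (a / 2) := by
        ext x; simp [and_comm]
      rw [this]; exact (isCompact_closedBall 0 (b + 1)).diff isOpen_ball
    have hGi : IntegrableOn G {x : E | a < ‖x‖ ∧ ‖x‖ < b} volume := by
      refine ((hGc.mono ?_).integrableOn_compact hK).mono_set ?_
      · intro x hx h0
        have : ‖x‖ = 0 := by rw [show x = 0 from h0, norm_zero]
        linarith [hx.1]
      · intro x hx; exact ⟨by linarith [hx.1], by linarith [hx.2]⟩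
    have hshell := Literature.Analysis.FluidPDE.setIntegral_shell_eq_integral_sphereIntegral
      (volume : Measure E) hGi ha.le
    rw [setIntegral_shell_fderiv_angular_eq_zero hu hv huv hq ha] at hshell
    rw [intervalIntegral.integral_of_le hab, integral_Ioc_eq_integral_Ioo]
    exact hshell.symm
  -- differentiate `b ↦ ∫_{r/2}^{b} h = 0` at `b = r`
  have hra : r / 2 < r := by linarith
  have hcont_r : ContinuousAt h r := hhc.continuousAt (Ioi_mem_nhds hr)
  have hii : IntervalIntegrable h volume (r / 2) r := by
    refine (hhc.mono fun ρ hρ => ?_).intervalIntegrable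
    rw [uIcc_of_le hra.le] at hρ
    exact show ρ ∈ Ioi (0 : ℝ) from lt_of_lt_of_le (by linarith) hρ.1
  have hmeas : StronglyMeasurableAtFilter h (𝓝 r) volume := by
    refine ContinuousOn.stronglyMeasurableAtFilter (s := Ioi 0) isOpen_Ioi hhc r hr
  have hFTC := intervalIntegral.integral_hasDerivAt_right hii hmeas hcont_r
  have hzero : HasDerivAt (fun b => ∫ ρ in (r / 2)..b, h ρ) 0 r := by
    have heq : (fun b => ∫ ρ in (r / 2)..b, h ρ) =ᶠ[𝓝 r] fun _ => 0 := by
      filter_upwards [Ioi_mem_nhds hra] with b hb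
      exact hint (by linarith) (le_of_lt hb)
    exact (hasDerivAt_const r (0 : ℝ)).congr_of_eventuallyEq heq
  have hhr : h r = 0 := hFTC.unique hzero
  have hpow : r ^ (Module.finrank ℝ E - 1) ≠ 0 := pow_ne_zero _ hr.ne'
  simpa [hh, hpow] using hhr

end Shell

end Literature.Analysis.Calculus
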